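import Literature.Probability.Percolation.ArmSeparationOutSlotsFour
import Literature.Probability.Percolation.ArmSeparationLanes
import HarnessLib

/-!
# Keys and ring positions: from the perimeter order of tips and targets to the order of their windows

Topic `Literature/Probability/Percolation`; family `crit-perc` / near-critical percolation on `𝕋`.
A brick of the near-critical arm-separation theorem for four arms of alternating colours
(P. Nolin, *Near-critical percolation in two dimensions*, EJP 13 (2008), Thm. 11 for `j = 4`,
`σ = BWBW` [arXiv 0711.4948: Thm. 10], landing step, §4.4 p. 12 with Prop. 12 (i)). The routing of
the four corridors (`ArmSeparationLanes.lean`) is decided on the PERIMETER of `∂Λ_{2M}` — a tip or a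
target is a frame `i < 6` and a row interval of that frame, its *key* is the perimeter coordinate
`frKey M i ξ` (the tree's `hexPos` of the framed point: `ξ + 2M, 4M + ξ, 4M - ξ, 8M + ξ, 10M + ξ, 10M - ξ`
on the frames `0, …, 5`) — while the corridors live on the ring roads, where the object occupies the
*window* of ring positions `[wlo, whi]` of the pieces of its side over its rows (one lateral index of
margin). This file proves that the second order follows the first:

* `frKey`, its block structure (`frKey_mem_block`) and orientation (increasing in the row on the frames
  `0, 1, 3, 4`, decreasing on `2, 5` — as `piecePos` lists the pieces);
* `RingObj` (frame, row interval), its window `wlo/whi` on a ring (`piecePos_mem_window`), the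
  frame-lexicographic order `Before g s` (with a gap of `g` chunks on a common frame) and
  `whi_lt_wlo_of_before` (`g = 3`); the cut position `cutPos` of a cut object and `whi_lt_cutPos`,
  `cutPos_lt_wlo` (`g = 2`);
* `before_of_frKey_lt` — key order of representative rows plus separation on a common frame gives `Before 3 s`;
  `frKey_lt_of_before` — the converse (`g ≥ 1`);
* `linPos` (positions read anticlockwise from the cut position), `linPos_window` (monotone along a window
  off the cut) and **`linPos_lt_of_cyc_lt`** — for two objects off a cut, the anticlockwise key order from
  the cut key (`Lanes.cyc`) gives the order of their windows read from the cut position (three cases; the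
  fourth is excluded by the cyclic order).

Everything here is proved; no named facts are introduced.

## References

* P. Nolin, Near-critical percolation in two dimensions, *Electron. J. Probab.* 13 (2008), §4.3
  Prop. 12 (i), §4.4 (arXiv 0711.4948: Prop. 11; proof of Thm. 10, p. 12) [Nolin2008].
* H. Kesten, Scaling relations for 2D-percolation, *Comm. Math. Phys.* 109 (1987), Lemma 2 [Kesten1987].

Tree: `piecePos`, `piecePos_eq_of_ne/two`, `piecePos_mem_block'`, `blockOff`, `blockEnd`,
`blockEnd_le_blockOff`, `latIdx`, `latIdx_spec`, `latIdx_mono`, `lat_gap`, `Lanes.cyc`.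
-/

namespace Literature.Probability.Percolation

open Lanes

/-! ### Keys -/

/-- **The perimeter key** of the row `ξ` of the frame `i` of `∂Λ_{2M}` (anticlockwise from the corner
between the sides `5` and `0`; the `hexPos` of the framed point). [folklore] -/
def frKey (M i : ℕ) (ξ : ℤ) : ℤ :=
  if i = 0 then ξ + 2 * M else if i = 1 then 4 * M + ξ else if i = 2 then 4 * M - ξ
  else if i = 3 then 8 * M + ξ else if i = 4 then 10 * M + ξ else 10 * M - ξ

/-- The key on the frame `0`. [folklore] -/
theorem frKey_zero (M : ℕ) (ξ : ℤ) : frKey M 0 ξ = ξ + 2 * M := by unfold frKey; simp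
/-- The key on the frame `1`. [folklore] -/
theorem frKey_one (M : ℕ) (ξ : ℤ) : frKey M 1 ξ = 4 * M + ξ := by unfold frKey; simp
/-- The key on the frame `2`. [folklore] -/
theorem frKey_two (M : ℕ) (ξ : ℤ) : frKey M 2 ξ = 4 * M - ξ := by unfold frKey; simp
/-- The key on the frame `3`. [folklore] -/
theorem frKey_three (M : ℕ) (ξ : ℤ) : frKey M 3 ξ = 8 * M + ξ := by unfold frKey; simp
/-- The key on the frame `4`. [folklore] -/
theorem frKey_four (M : ℕ) (ξ : ℤ) : frKey M 4 ξ = 10 * M + ξ := by unfold frKey; simp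
/-- The key on the frame `5`. [folklore] -/
theorem frKey_five (M : ℕ) (ξ : ℤ) : frKey M 5 ξ = 10 * M - ξ := by unfold frKey; simp

/-- **Keys of interior rows lie strictly inside the block of their frame**: `2Mi < frKey M i ξ < 2M(i+1)`
for `-2M < ξ < 0`, `i < 6`. [folklore] -/
theorem frKey_mem_block {M i : ℕ} (hi : i < 6) {ξ : ℤ} (h1 : -(2 * (M : ℤ)) < ξ) (h2 : ξ < 0) :
    2 * (M : ℤ) * i < frKey M i ξ ∧ frKey M i ξ < 2 * (M : ℤ) * (i + 1) := by
  interval_cases i <;>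
    simp only [frKey_zero, frKey_one, frKey_two, frKey_three, frKey_four, frKey_five, Nat.cast_zero, Nat.cast_one, Nat.cast_ofNat] <;>
    constructor <;> linarith

/-- **Orientation of the keys**: increasing in the row on the frames `0, 1, 3, 4`, decreasing on `2, 5`. [folklore] -/
theorem frKey_lt_frKey_iff {M i : ℕ} (hi : i < 6) {ξ ξ' : ℤ} :
    frKey M i ξ < frKey M i ξ' ↔ (i % 3 ≠ 2 ∧ ξ < ξ') ∨ (i % 3 = 2 ∧ ξ' < ξ) := by
  interval_cases i <;>
    simp only [frKey_zero, frKey_one, frKey_two, frKey_three, frKey_four, frKey_five, Nat.reduceMod, ne_eq,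
      not_true_eq_false, true_and, false_and, false_or] <;> omega

/-- **Index gap from a non-strict lateral gap**: `-r + ι s ≤ ξ`, `ξ' < -r + (ι'+1) s`, `ξ + c s ≤ ξ'` give
`ι + c ≤ ι'`. [folklore] -/
theorem lat_gap_le {s ι ι' c : ℕ} {r ξ ξ' : ℤ} (hs : 0 < s) (h1 : -r + (ι : ℤ) * s ≤ ξ)
    (h2 : ξ' < -r + ((ι' : ℤ) + 1) * s) (hgap : ξ + (c : ℤ) * s ≤ ξ') : ι + c ≤ ι' := by
  by_contra h'
  push Not at h'
  have : (ι' : ℤ) + 1 ≤ ι + c := by exact_mod_cast h'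
  have hs' : (0 : ℤ) < s := by exact_mod_cast hs
  nlinarith

/-! ### Objects and their windows -/

/-- **An object of the routing**: a frame and a row interval of that frame (a tip: the spoke row, a
target: the rows of the approach tube). [folklore] -/
structure RingObj where
  /-- frame -/
  fr : ℕ
  /-- lowest row -/
  lo : ℤ
  /-- highest row -/
  hi : ℤ

namespace RingObj

variable (n s r : ℕ) (X : RingObj)

/-- first position of the window of `X` on the ring with `n` chunks of length `s`, radius `r = n s`:
the pieces of lateral indices `latIdx lo - 1, …, latIdx hi + 1` of the side `fr` and their connectors [folklore] -/
def wlo : ℕ := min (piecePos n X.fr (latIdx s r X.lo - 1)) (piecePos n X.fr (latIdx s r X.hi + 1))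
/-- last position of the window [folklore] -/
def whi : ℕ := max (piecePos n X.fr (latIdx s r X.lo - 1)) (piecePos n X.fr (latIdx s r X.hi + 1)) + 1

/-- **The object is in range**: frame `< 6`, rows `lo ≤ hi` interior rows of the side of `∂Λ_{2M}`, at
least two chunks above its bottom and four chunks below its top; the ring (radius `r`) lies outside `Λ_{2M}`. [folklore] -/
structure OK (M : ℕ) : Prop where
  /-- frame -/
  hfr : X.fr < 6
  /-- interval -/
  hlohi : X.lo ≤ X.hi
  /-- above the bottom -/
  hlo : -(2 * (M : ℤ)) + 2 * s ≤ X.lo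
  /-- below the top -/
  hhi : X.hi + 4 * s < 0
  /-- the ring is outside -/
  hMr : 2 * M ≤ r

variable {n s r X}

/-- Lateral indices of an object in range: `2 ≤ latIdx lo ≤ latIdx hi`, `latIdx hi + 4 < n`. [folklore] -/
theorem OK.idx {M : ℕ} (hX : X.OK s r M) (hs : 1 ≤ s) (hns : (n : ℤ) * s = r) :
    2 ≤ latIdx s r X.lo ∧ latIdx s r X.lo ≤ latIdx s r X.hi ∧ latIdx s r X.hi + 4 < n := by
  have hMr : (2 * M : ℤ) ≤ r := by exact_mod_cast hX.hMr
  have h1 : -(r : ℤ) ≤ X.lo := by linarith [hX.hlo, (show (0 : ℤ) ≤ s from by positivity)]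
  have h2 : -(r : ℤ) ≤ X.hi := le_trans h1 hX.hlohi
  have hspec := latIdx_spec (s := s) (r := r) hs h1
  have hspec' := latIdx_spec (s := s) (r := r) hs h2
  refine ⟨?_, latIdx_mono hX.hlohi, ?_⟩
  · by_contra h; push Not at h
    have : (latIdx s r X.lo : ℤ) + 1 ≤ 2 := by exact_mod_cast h
    have hs0 : (0 : ℤ) < s := by exact_mod_cast hs
    nlinarith [hspec.2, hX.hlo]
  · by_contra h; push Not at h
    have : (n : ℤ) ≤ latIdx s r X.hi + 4 := by exact_mod_cast h
    have hs0 : (0 : ℤ) < s := by exact_mod_cast hs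
    nlinarith [hspec'.1, hX.hhi]

/-- The window lies in the block of its side, inside the ring, with one position of margin at the top:
`blockOff ≤ wlo ≤ whi`, `whi + 1 < blockEnd ≤ 12n - 4`. [folklore] -/
theorem window_mem_block {M : ℕ} (hX : X.OK s r M) (hs : 1 ≤ s) (hns : (n : ℤ) * s = r) :
    blockOff n X.fr ≤ X.wlo n s r ∧ X.wlo n s r ≤ X.whi n s r ∧ X.whi n s r + 1 < blockEnd n X.fr ∧ blockEnd n X.fr ≤ 12 * n - 4 := by
  obtain ⟨i1, i2, i3⟩ := hX.idx hs hns
  have hfr := hX.hfr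
  have hn : 1 ≤ n := by omega
  have hend : blockEnd n X.fr ≤ 12 * n - 4 := by
    generalize X.fr = f at hfr
    interval_cases f <;> simp only [blockEnd] <;> omega
  have p1 := piecePos_mem_block' (n := n) hn hfr (show latIdx s r X.lo - 1 < n by omega)
  have p2 := piecePos_mem_block' (n := n) hn hfr (show latIdx s r X.hi + 1 < n by omega)
  refine ⟨?_, ?_, ?_, hend⟩
  · unfold wlo; exact le_min p1.1 p2.1
  · unfold wlo whi; omega
  · unfold whi
    by_cases h2 : X.fr % 3 = 2
    · have p3 := piecePos_mem_block' (n := n) hn hfr (show latIdx s r X.lo - 2 < n by omega)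
      rw [piecePos_eq_of_two h2] at p1 p2 p3 ⊢; rw [piecePos_eq_of_two h2]
      simp only [max_def]; split_ifs <;> omega
    · have p3 := piecePos_mem_block' (n := n) hn hfr (show latIdx s r X.hi + 2 < n by omega)
      rw [piecePos_eq_of_ne h2] at p1 p2 p3 ⊢; rw [piecePos_eq_of_ne h2]
      simp only [max_def]; split_ifs <;> omega

/-- **A row of the object gives a piece of its window**: for `ρ ∈ [lo, hi]` the piece of lateral index
`latIdx ρ` (and its successor position) lies in `[wlo, whi]`. [folklore] -/
theorem piecePos_mem_window {M : ℕ} (hX : X.OK s r M) (hs : 1 ≤ s) (hns : (n : ℤ) * s = r) {ι : ℕ}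
    (h1 : latIdx s r X.lo - 1 ≤ ι) (h2 : ι ≤ latIdx s r X.hi + 1) :
    X.wlo n s r ≤ piecePos n X.fr ι ∧ piecePos n X.fr ι + 1 ≤ X.whi n s r := by
  obtain ⟨x1, x2, x3⟩ := hX.idx hs hns
  unfold wlo whi
  by_cases hf : X.fr % 3 = 2
  · rw [piecePos_eq_of_two hf, piecePos_eq_of_two hf, piecePos_eq_of_two hf]
    simp only [min_def, max_def]; split_ifs <;> omega
  · rw [piecePos_eq_of_ne hf, piecePos_eq_of_ne hf, piecePos_eq_of_ne hf]
    simp only [min_def, max_def]; split_ifs <;> omega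

/-- **Lateral index of a row shifted by whole chunks.** [folklore] -/
theorem _root_.Literature.Probability.Percolation.latIdx_row_add_mul {s r : ℕ} (hs : 1 ≤ s) {ξ : ℤ} (hξ : -(r : ℤ) ≤ ξ) (m : ℕ) :
    latIdx s r (ξ + m * s) = latIdx s r ξ + m := by
  unfold latIdx
  have h0 : (ξ + m * s + r).toNat = (ξ + r).toNat + m * s := by
    have : (0 : ℤ) ≤ m * s := by positivity
    omega
  rw [h0, Nat.add_mul_div_right _ _ (by omega)]

/-! ### Order of objects and of their windows -/

/-- **Frame-lexicographic order with a gap of `g` chunks**: `X` is before `Y` if its frame is smaller,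
or on a common frame its rows are at least `g` chunks before those of `Y` in the orientation of the
frame (increasing rows on the frames `0, 1, 3, 4`, decreasing on `2, 5`). [folklore] -/
def Before (g s : ℕ) (X Y : RingObj) : Prop :=
  X.fr < Y.fr ∨ (X.fr = Y.fr ∧ (X.fr % 3 ≠ 2 → X.hi + g * s ≤ Y.lo) ∧ (X.fr % 3 = 2 → Y.hi + g * s ≤ X.lo))

/-- **The windows of ordered objects are ordered**: `whi X < wlo Y` when `X` is three chunks before `Y`. [folklore] -/
theorem whi_lt_wlo_of_before {M : ℕ} {Y : RingObj} (hX : X.OK s r M) (hY : Y.OK s r M) (hs : 1 ≤ s) (hns : (n : ℤ) * s = r)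
    (h : Before 3 s X Y) : X.whi n s r < Y.wlo n s r := by
  obtain ⟨x1, x2, x3⟩ := hX.idx hs hns
  obtain ⟨y1, y2, y3⟩ := hY.idx hs hns
  have hn : 1 ≤ n := by omega
  rcases h with h | ⟨hfe, hA, hB⟩
  · -- different frames
    obtain ⟨-, -, bx, -⟩ := window_mem_block (n := n) hX hs hns
    obtain ⟨byo, -⟩ := window_mem_block (n := n) hY hs hns
    have := blockEnd_le_blockOff (n := n) h hY.hfr
    omega
  · -- common frame
    have hs0 : 0 < s := hs
    have hMr : (2 * M : ℤ) ≤ r := by exact_mod_cast hX.hMr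
    have hr1 : -(r : ℤ) ≤ X.lo := by linarith [hX.hlo, (show (0 : ℤ) ≤ s from by positivity)]
    have hr2 : -(r : ℤ) ≤ Y.lo := by linarith [hY.hlo, (show (0 : ℤ) ≤ s from by positivity)]
    have hXhi := latIdx_spec (s := s) (r := r) hs (le_trans hr1 hX.hlohi)
    have hYhi := latIdx_spec (s := s) (r := r) hs (le_trans hr2 hY.hlohi)
    have hXlo := latIdx_spec (s := s) (r := r) hs hr1
    have hYlo := latIdx_spec (s := s) (r := r) hs hr2
    by_cases h2 : X.fr % 3 = 2
    · have hgap : latIdx s r Y.hi + 3 ≤ latIdx s r X.lo :=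
        lat_gap_le (c := 3) hs0 hYhi.1 hXlo.2 (by have h' := hB h2; push_cast at h' ⊢; linarith)
      have hfr := hX.hfr
      generalize hfe' : X.fr = f at hfr h2 hfe
      unfold whi wlo
      rw [hfe', ← hfe, piecePos_eq_of_two h2, piecePos_eq_of_two h2, piecePos_eq_of_two h2, piecePos_eq_of_two h2]
      simp only [max_def, min_def]
      split_ifs <;> omega
    · have hgap : latIdx s r X.hi + 3 ≤ latIdx s r Y.lo :=
        lat_gap_le (c := 3) hs0 hXhi.1 hYlo.2 (by have h' := hA h2; push_cast at h' ⊢; linarith)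
      have hfr := hX.hfr
      generalize hfe' : X.fr = f at hfr h2 hfe
      unfold whi wlo
      rw [hfe', ← hfe, piecePos_eq_of_ne h2, piecePos_eq_of_ne h2, piecePos_eq_of_ne h2, piecePos_eq_of_ne h2]
      simp only [max_def, min_def]
      split_ifs <;> omega

/-- **The cut position**: the piece of the lowest row of the cut object. [folklore] -/
def cutPos (n' s' r' : ℕ) (C : RingObj) : ℕ := piecePos n' C.fr (latIdx s' r' C.lo)

/-- The cut position lies in the window of the cut object (hence inside the ring). [folklore] -/
theorem wlo_le_cutPos {M : ℕ} (hC : X.OK s r M) (hs : 1 ≤ s) (hns : (n : ℤ) * s = r) :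
    X.wlo n s r ≤ X.cutPos n s r ∧ X.cutPos n s r + 1 ≤ X.whi n s r := by
  obtain ⟨-, x2, -⟩ := hC.idx hs hns
  exact piecePos_mem_window hC hs hns (by omega) (by omega)

/-- **An object two chunks before the cut has its window before the cut position.** [folklore] -/
theorem whi_lt_cutPos {M : ℕ} {C : RingObj} (hX : X.OK s r M) (hC : C.OK s r M) (hs : 1 ≤ s) (hns : (n : ℤ) * s = r)
    (h : Before 2 s X C) : X.whi n s r < C.cutPos n s r := by
  obtain ⟨x1, x2, x3⟩ := hX.idx hs hns
  obtain ⟨y1, y2, y3⟩ := hC.idx hs hns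
  have hn : 1 ≤ n := by omega
  rcases h with h | ⟨hfe, hA, hB⟩
  · obtain ⟨-, -, bx, -⟩ := window_mem_block (n := n) hX hs hns
    obtain ⟨byo, -⟩ := window_mem_block (n := n) hC hs hns
    have := blockEnd_le_blockOff (n := n) h hC.hfr
    have := (wlo_le_cutPos (n := n) hC hs hns).1
    omega
  · have hs0 : 0 < s := hs
    have hMr : (2 * M : ℤ) ≤ r := by exact_mod_cast hX.hMr
    have hr1 : -(r : ℤ) ≤ X.lo := by linarith [hX.hlo, (show (0 : ℤ) ≤ s from by positivity)]
    have hr2 : -(r : ℤ) ≤ C.lo := by linarith [hC.hlo, (show (0 : ℤ) ≤ s from by positivity)]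
    have hXhi := latIdx_spec (s := s) (r := r) hs (le_trans hr1 hX.hlohi)
    have hChi := latIdx_spec (s := s) (r := r) hs (le_trans hr2 hC.hlohi)
    have hXlo := latIdx_spec (s := s) (r := r) hs hr1
    have hClo := latIdx_spec (s := s) (r := r) hs hr2
    by_cases h2 : X.fr % 3 = 2
    · have hgap : latIdx s r C.hi + 2 ≤ latIdx s r X.lo :=
        lat_gap_le (c := 2) hs0 hChi.1 hXlo.2 (by have h' := hB h2; push_cast at h' ⊢; linarith)
      have hfr := hX.hfr
      generalize hfe' : X.fr = f at hfr h2 hfe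
      unfold whi cutPos
      rw [hfe', ← hfe, piecePos_eq_of_two h2, piecePos_eq_of_two h2, piecePos_eq_of_two h2]
      simp only [max_def]
      split_ifs <;> omega
    · have hgap : latIdx s r X.hi + 2 ≤ latIdx s r C.lo :=
        lat_gap_le (c := 2) hs0 hXhi.1 hClo.2 (by have h' := hA h2; push_cast at h' ⊢; linarith)
      have hfr := hX.hfr
      generalize hfe' : X.fr = f at hfr h2 hfe
      unfold whi cutPos
      rw [hfe', ← hfe, piecePos_eq_of_ne h2, piecePos_eq_of_ne h2, piecePos_eq_of_ne h2]
      simp only [max_def]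
      split_ifs <;> omega

/-- **An object two chunks after the cut has its window after the cut position.** [folklore] -/
theorem cutPos_lt_wlo {M : ℕ} {C : RingObj} (hX : X.OK s r M) (hC : C.OK s r M) (hs : 1 ≤ s) (hns : (n : ℤ) * s = r)
    (h : Before 2 s C X) : C.cutPos n s r < X.wlo n s r := by
  obtain ⟨x1, x2, x3⟩ := hX.idx hs hns
  obtain ⟨y1, y2, y3⟩ := hC.idx hs hns
  have hn : 1 ≤ n := by omega
  rcases h with h | ⟨hfe, hA, hB⟩
  · obtain ⟨bxo, -⟩ := window_mem_block (n := n) hX hs hns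
    obtain ⟨-, -, bc, -⟩ := window_mem_block (n := n) hC hs hns
    have := blockEnd_le_blockOff (n := n) h hX.hfr
    have := (wlo_le_cutPos (n := n) hC hs hns).2
    omega
  · have hs0 : 0 < s := hs
    have hMr : (2 * M : ℤ) ≤ r := by exact_mod_cast hX.hMr
    have hr1 : -(r : ℤ) ≤ X.lo := by linarith [hX.hlo, (show (0 : ℤ) ≤ s from by positivity)]
    have hr2 : -(r : ℤ) ≤ C.lo := by linarith [hC.hlo, (show (0 : ℤ) ≤ s from by positivity)]
    have hXhi := latIdx_spec (s := s) (r := r) hs (le_trans hr1 hX.hlohi)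
    have hChi := latIdx_spec (s := s) (r := r) hs (le_trans hr2 hC.hlohi)
    have hXlo := latIdx_spec (s := s) (r := r) hs hr1
    have hClo := latIdx_spec (s := s) (r := r) hs hr2
    by_cases h2 : C.fr % 3 = 2
    · have hgap : latIdx s r X.hi + 2 ≤ latIdx s r C.lo :=
        lat_gap_le (c := 2) hs0 hXhi.1 hClo.2 (by have h' := hB h2; push_cast at h' ⊢; linarith)
      have hfr := hC.hfr
      generalize hfe' : C.fr = f at hfr h2 hfe
      unfold wlo cutPos
      rw [hfe', ← hfe, piecePos_eq_of_two h2, piecePos_eq_of_two h2, piecePos_eq_of_two h2]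
      simp only [min_def]
      split_ifs <;> omega
    · have hgap : latIdx s r C.hi + 2 ≤ latIdx s r X.lo :=
        lat_gap_le (c := 2) hs0 hChi.1 hXlo.2 (by have h' := hA h2; push_cast at h' ⊢; linarith)
      have hfr := hC.hfr
      generalize hfe' : C.fr = f at hfr h2 hfe
      unfold wlo cutPos
      rw [hfe', ← hfe, piecePos_eq_of_ne h2, piecePos_eq_of_ne h2, piecePos_eq_of_ne h2]
      simp only [min_def]
      split_ifs <;> omega

/-- **Separated objects**: on a common frame the two row intervals are at least three chunks apart. [folklore] -/
def Sep (s : ℕ) (X Y : RingObj) : Prop := X.fr = Y.fr → X.hi + 3 * s ≤ Y.lo ∨ Y.hi + 3 * s ≤ X.lo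

/-- **Key order of representative rows gives the frame-lexicographic order**: for rows `ρX ∈ [lo X, hi X]`,
`ρY ∈ [lo Y, hi Y]` of separated objects in range with `frKey (fr X) ρX < frKey (fr Y) ρY`, `X` is
before `Y`. [folklore] -/
theorem before_of_frKey_lt {M : ℕ} {Y : RingObj} (hX : X.OK s r M) (hY : Y.OK s r M) (hs : 1 ≤ s) (hsep : Sep s X Y)
    {ρX ρY : ℤ} (hρX : X.lo ≤ ρX ∧ ρX ≤ X.hi) (hρY : Y.lo ≤ ρY ∧ ρY ≤ Y.hi) (hlt : frKey M X.fr ρX < frKey M Y.fr ρY) :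
    Before 3 s X Y := by
  have hs0 : (1 : ℤ) ≤ s := by exact_mod_cast hs
  have bx := frKey_mem_block (M := M) hX.hfr (ξ := ρX) (by linarith [hX.hlo, hρX.1]) (by linarith [hX.hhi, hρX.2])
  have by' := frKey_mem_block (M := M) hY.hfr (ξ := ρY) (by linarith [hY.hlo, hρY.1]) (by linarith [hY.hhi, hρY.2])
  rcases lt_trichotomy X.fr Y.fr with h | h | h
  · exact Or.inl h
  · right
    have hor := (frKey_lt_frKey_iff (M := M) hX.hfr (ξ := ρX) (ξ' := ρY)).1 (by rw [h] at hlt ⊢; exact hlt)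
    refine ⟨h, fun h2 => ?_, fun h2 => ?_⟩
    · rcases hsep h with hs' | hs'
      · exact_mod_cast hs'
      · exfalso; rcases hor with ⟨-, hor⟩ | ⟨hor, -⟩
        · linarith [hρX.1, hρY.2]
        · exact h2 hor
    · rcases hsep h with hs' | hs'
      · exfalso; rcases hor with ⟨hor, -⟩ | ⟨-, hor⟩
        · exact hor h2
        · linarith [hρX.2, hρY.1]
      · exact_mod_cast hs'
  · exfalso
    have h1 : (Y.fr : ℤ) + 1 ≤ X.fr := by exact_mod_cast h
    have hM : (0 : ℤ) ≤ M := by positivity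
    nlinarith [bx.1, by'.2]

/-- **The frame-lexicographic order (gap `g ≥ 1`) gives the key order** of all rows, with a gap of a chunk. [folklore] -/
theorem frKey_lt_of_before {M g : ℕ} {Y : RingObj} (hX : X.OK s r M) (hY : Y.OK s r M) (hs : 1 ≤ s) (hg : 1 ≤ g)
    (h : Before g s X Y) {ρX ρY : ℤ} (hρX : X.lo ≤ ρX ∧ ρX ≤ X.hi) (hρY : Y.lo ≤ ρY ∧ ρY ≤ Y.hi) :
    frKey M X.fr ρX + s ≤ frKey M Y.fr ρY := by
  have hs0 : (1 : ℤ) ≤ s := by exact_mod_cast hs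
  have hgs : (s : ℤ) ≤ (g : ℤ) * s := le_mul_of_one_le_left (by positivity) (by exact_mod_cast hg)
  have bx := frKey_mem_block (M := M) hX.hfr (ξ := ρX) (by linarith [hX.hlo, hρX.1]) (by linarith [hX.hhi, hρX.2])
  have by' := frKey_mem_block (M := M) hY.hfr (ξ := ρY) (by linarith [hY.hlo, hρY.1]) (by linarith [hY.hhi, hρY.2])
  rcases h with h | ⟨hfe, hA, hB⟩
  · -- different blocks; the key of `ρX` is at least `s` below the end of its block
    have h1 : (X.fr : ℤ) + 1 ≤ Y.fr := by exact_mod_cast h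
    have hM : (0 : ℤ) ≤ M := by positivity
    have hend : frKey M X.fr ρX + s ≤ 2 * (M : ℤ) * (X.fr + 1) := by
      have hfr := hX.hfr
      have hlo := hX.hlo; have hhi := hX.hhi
      generalize hfe : X.fr = f at hfr
      interval_cases f <;>
        simp only [frKey_zero, frKey_one, frKey_two, frKey_three, frKey_four, frKey_five, Nat.cast_zero, Nat.cast_one,
          Nat.cast_ofNat] <;> linarith [hρX.1, hρX.2]
    nlinarith [by'.1]
  · have hfr := hX.hfr
    rw [← hfe]
    by_cases h2 : X.fr % 3 = 2
    · have hB' : Y.hi + s ≤ X.lo := by linarith [hB h2]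
      clear hA hB hgs
      generalize hfe' : X.fr = f at hfr h2
      interval_cases f <;> simp only [frKey_zero, frKey_one, frKey_two, frKey_three, frKey_four, frKey_five] <;> omega
    · have hA' : X.hi + s ≤ Y.lo := by linarith [hA h2]
      clear hA hB hgs
      generalize hfe' : X.fr = f at hfr h2
      interval_cases f <;> simp only [frKey_zero, frKey_one, frKey_two, frKey_three, frKey_four, frKey_five] <;> omega

/-! ### Reading positions from a cut -/

/-- **Position read anticlockwise from the cut position `pc`** on a ring of `G` tubes. [folklore] -/
def _root_.Literature.Probability.Percolation.linPos (G pc p : ℕ) : ℕ := (p + G - pc) % G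

/-- Positions before the cut. [folklore] -/
theorem _root_.Literature.Probability.Percolation.linPos_of_lt {G pc p : ℕ} (hpc : pc < G) (h : p < pc) :
    linPos G pc p = p + G - pc := by
  unfold linPos; exact Nat.mod_eq_of_lt (by omega)

/-- Positions after the cut. [folklore] -/
theorem _root_.Literature.Probability.Percolation.linPos_of_ge {G pc p : ℕ} (hp : p < G) (h : pc ≤ p) :
    linPos G pc p = p - pc := by
  unfold linPos; rw [Nat.mod_eq_sub_mod (by omega), Nat.mod_eq_of_lt (by omega)]; omega

/-- **Read positions are monotone along a window off the cut**: for an object two chunks before or after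
the cut object `C` and a position `p` of its window, `linPos (wlo) ≤ linPos p ≤ linPos (whi)` (read from
the cut position of `C` on the ring `G = 12n - 4`). [folklore] -/
theorem linPos_window {M : ℕ} {C : RingObj} (hX : X.OK s r M) (hC : C.OK s r M) (hs : 1 ≤ s) (hns : (n : ℤ) * s = r)
    (hXC : Before 2 s X C ∨ Before 2 s C X) {p : ℕ} (hp : X.wlo n s r ≤ p ∧ p ≤ X.whi n s r) :
    linPos (12 * n - 4) (C.cutPos n s r) (X.wlo n s r) ≤ linPos (12 * n - 4) (C.cutPos n s r) p ∧
      linPos (12 * n - 4) (C.cutPos n s r) p ≤ linPos (12 * n - 4) (C.cutPos n s r) (X.whi n s r) := by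
  obtain ⟨-, wx, bx, ex⟩ := window_mem_block (n := n) hX hs hns
  obtain ⟨-, -, bc, ec⟩ := window_mem_block (n := n) hC hs hns
  have hpc := (wlo_le_cutPos (n := n) hC hs hns).2
  have hpcG : C.cutPos n s r < 12 * n - 4 := by omega
  rcases hXC with h | h
  · have w := whi_lt_cutPos (n := n) hX hC hs hns h
    rw [linPos_of_lt hpcG (by omega), linPos_of_lt hpcG (by omega), linPos_of_lt hpcG w]
    omega
  · have w := cutPos_lt_wlo (n := n) hX hC hs hns h
    rw [linPos_of_ge (by omega) (by omega), linPos_of_ge (by omega) (by omega), linPos_of_ge (by omega) (by omega)]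
    omega

/-- **From the perimeter order to the ring order.** Let `C` be a cut object in range; let `X`, `Y` be
objects in range, each two chunks before or after the cut, separated from each other, with
representative rows `ρX`, `ρY` whose keys are in the anticlockwise order
`cyc P c (frKey X ρX) < cyc P c (frKey Y ρY)` from the key `c` of the cut row `C.lo` (`P >` the key of `Y`).
Then the window of `X` read from the cut position ends before the window of `Y` begins:
`linPos G pc (whi X) < linPos G pc (wlo Y)` (`G = 12n - 4`, `pc = cutPos C`). [cite: Nolin2008, §4.3 Prop. 12 (i) (arXiv 0711.4948: Prop. 11; relocation of landing areas)] -/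
theorem linPos_lt_of_cyc_lt {M : ℕ} {Y C : RingObj} (hX : X.OK s r M) (hY : Y.OK s r M) (hC : C.OK s r M) (hs : 1 ≤ s)
    (hns : (n : ℤ) * s = r) (hsep : Sep s X Y) (hXC : Before 2 s X C ∨ Before 2 s C X) (hYC : Before 2 s Y C ∨ Before 2 s C Y)
    {ρX ρY : ℤ} (hρX : X.lo ≤ ρX ∧ ρX ≤ X.hi) (hρY : Y.lo ≤ ρY ∧ ρY ≤ Y.hi) {P : ℤ} (hPY : frKey M Y.fr ρY < P)
    (hlt : cyc P (frKey M C.fr C.lo) (frKey M X.fr ρX) < cyc P (frKey M C.fr C.lo) (frKey M Y.fr ρY)) :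
    linPos (12 * n - 4) (C.cutPos n s r) (X.whi n s r) < linPos (12 * n - 4) (C.cutPos n s r) (Y.wlo n s r) := by
  obtain ⟨-, wx, bx, ex⟩ := window_mem_block (n := n) hX hs hns
  obtain ⟨-, wy, byy, ey⟩ := window_mem_block (n := n) hY hs hns
  obtain ⟨-, -, bc, ec⟩ := window_mem_block (n := n) hC hs hns
  have hpc := (wlo_le_cutPos (n := n) hC hs hns).2
  set pc := C.cutPos n s r with hpcdef
  have hpcG : pc < 12 * n - 4 := by omega
  have hxG : X.whi n s r < 12 * n - 4 := by omega
  have hyG : Y.wlo n s r < 12 * n - 4 := by omega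
  have hρC : C.lo ≤ C.lo ∧ C.lo ≤ C.hi := ⟨le_rfl, hC.hlohi⟩
  -- key consequences of the positions relative to the cut
  have hs1 : (1 : ℤ) ≤ s := by exact_mod_cast hs
  have kXC : Before 2 s X C → frKey M X.fr ρX < frKey M C.fr C.lo := fun h => by
    have h1 := frKey_lt_of_before (M := M) hX hC hs (by norm_num) h hρX hρC
    linarith
  have kCX : Before 2 s C X → frKey M C.fr C.lo < frKey M X.fr ρX := fun h => by
    have h1 := frKey_lt_of_before (M := M) hC hX hs (by norm_num) h hρC hρX
    linarith
  have kYC : Before 2 s Y C → frKey M Y.fr ρY < frKey M C.fr C.lo := fun h => by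
    have h1 := frKey_lt_of_before (M := M) hY hC hs (by norm_num) h hρY hρC
    linarith
  have kCY : Before 2 s C Y → frKey M C.fr C.lo < frKey M Y.fr ρY := fun h => by
    have h1 := frKey_lt_of_before (M := M) hC hY hs (by norm_num) h hρC hρY
    linarith
  -- window consequences
  have wXC : Before 2 s X C → X.whi n s r < pc := fun h => whi_lt_cutPos (n := n) hX hC hs hns h
  have wCX : Before 2 s C X → pc < X.wlo n s r := fun h => cutPos_lt_wlo (n := n) hX hC hs hns h
  have wYC : Before 2 s Y C → Y.whi n s r < pc := fun h => whi_lt_cutPos (n := n) hY hC hs hns h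
  have wCY : Before 2 s C Y → pc < Y.wlo n s r := fun h => cutPos_lt_wlo (n := n) hY hC hs hns h
  have hs0 : (0 : ℤ) ≤ s := by positivity
  have bX := frKey_mem_block (M := M) hX.hfr (ξ := ρX) (by linarith [hX.hlo, hρX.1]) (by linarith [hX.hhi, hρX.2])
  have bY := frKey_mem_block (M := M) hY.hfr (ξ := ρY) (by linarith [hY.hlo, hρY.1]) (by linarith [hY.hhi, hρY.2])
  have hX0 : (0 : ℤ) ≤ 2 * (M : ℤ) * X.fr := by positivity
  have hY0 : (0 : ℤ) ≤ 2 * (M : ℤ) * Y.fr := by positivity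
  rcases hXC with hXC | hXC <;> rcases hYC with hYC | hYC
  · -- both before the cut: keys below `c`, same branch of `cyc`
    have k1 := kXC hXC; have k2 := kYC hYC
    have w1 := wXC hXC; have w2 := wYC hYC
    have hk : frKey M X.fr ρX < frKey M Y.fr ρY := by unfold cyc at hlt; split_ifs at hlt <;> omega
    have hw := whi_lt_wlo_of_before (n := n) hX hY hs hns (before_of_frKey_lt (M := M) hX hY hs hsep hρX hρY hk)
    rw [linPos_of_lt hpcG w1, linPos_of_lt hpcG (by omega : Y.wlo n s r < pc)]
    omega
  · -- `X` before the cut, `Y` after: excluded by the cyclic order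
    exfalso
    have k1 := kXC hXC; have k2 := kCY hYC
    unfold cyc at hlt; split_ifs at hlt <;> omega
  · -- `X` after the cut, `Y` before: `X` reads small, `Y` reads large
    have w1 := wCX hXC; have w2 := wYC hYC
    rw [linPos_of_ge hxG (by omega), linPos_of_lt hpcG (by omega)]
    omega
  · -- both after the cut
    have k1 := kCX hXC; have k2 := kCY hYC
    have w1 := wCX hXC; have w2 := wCY hYC
    have hk : frKey M X.fr ρX < frKey M Y.fr ρY := by unfold cyc at hlt; split_ifs at hlt <;> omega
    have hw := whi_lt_wlo_of_before (n := n) hX hY hs hns (before_of_frKey_lt (M := M) hX hY hs hsep hρX hρY hk)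
    rw [linPos_of_ge hxG (by omega), linPos_of_ge hyG (by omega)]
    omega

end RingObj

end Literature.Probability.Percolation
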